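import Summits.QuantumFields.Balaban3D.Proofs.AlphaAC
import Summits.QuantumFields.Balaban3D.Proofs.LeavesReprAC
import Summits.QuantumFields.Balaban3D.Proofs.LeavesCumAC

/-!
# `Summit.QuantumFields.Balaban3D.Proofs.AlphaAdaptersAC` — the (α) → step-leaf ADAPTERS at the AC pieces: seat p3's `AlphaRepr` (C5 `repr33_60`,
# C6 `vacuumWhole`, C7 `decomp35_61`, C8 `norm35`, B20 `logZT_le`), `AlphaCumulant` (C3 `cumulant58`, C4 `cumulantLower`, B21 `PprT_le`) and
# `AlphaBound55` (`Rm ≥ 0`, C1 `bound55`, C2 `bound55Lower`) twinned over `StandardAC.ExternalInputsAC` / `InputsAC.piecesAC` with the AC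
# providers `LeavesReprAC`, `LeavesCumAC`, `Bound55AC` — lane `pub-balaban3d`, seat alpha-1 (definition request `defn-AlphaInputsT3AC`; feed
# `Thm2AC`).  C10 `oldOutside` (seat p5's `Run3OldOutside`) is not yet twinned; `Thm2AC` takes it as an explicit residual hypothesis.

Statements and proofs are the lane's with `pieces ↦ piecesAC`, `towerW ↦ towerWAC`, `Fibre49/57Low ↦ Fibre49AC/57LowAC`; constants, thresholds
and run slots are discharged exactly as there.  [folklore] bookkeeping; nothing of [Balaban1985UV3] newly asserted.
-/

noncomputable section

namespace Summit.QuantumFields.Balaban3D.Proofs.AlphaAdaptersAC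

open scoped Topology BigOperators Nat
open MeasureTheory Metric
open Literature.MathematicalPhysics.QuantumFieldTheory.Balaban1983to89
open Literature.MathematicalPhysics.QuantumFieldTheory.Balaban1983to89.B10
open Literature.MathematicalPhysics.QuantumFieldTheory.Balaban1983to89.B10SectAGathering
open Literature.MathematicalPhysics.QuantumFieldTheory.Balaban1983to89.B10Assembly
open Literature.MathematicalPhysics.QuantumFieldTheory.Balaban1983to89.B10SectCExpansion (Bound44)
open Literature.MathematicalPhysics.QuantumFieldTheory.Balaban1983to89.B10Eq24Cumulant (chiMeasure truncExp)
open Literature.MathematicalPhysics.QuantumFieldTheory.Balaban1983to89.B12TreeDecay (kappa₀ K₀ K₀_pos)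
open Literature.MathematicalPhysics.QuantumFieldTheory.Balaban1983to89.TreeLengthTorus (tsys tcubeSys TPt)
open Literature.MathematicalPhysics.QuantumFieldTheory.Balaban1985CMP102
open Literature.MathematicalPhysics.QuantumFieldTheory.Balaban1985CMP102.Setting
open Literature.MathematicalPhysics.QuantumFieldTheory.Balaban1985CMP102.Binders
  (ChartAnalyticityAsCited FarTermsDecayAsCited Norm35StepAsCited LogZTExtensiveAsCited LogZLocalizedAsCited GraphTerms GraphRep23AsCited)
open Summit.QuantumFields.Balaban3D.Carriers
open Summit.QuantumFields.Balaban3D.Proofs.ScalesArithmetic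
open Summit.QuantumFields.Balaban3D.Proofs.Constants
open Summit.QuantumFields.Balaban3D.Proofs.Representation33
open Summit.QuantumFields.Balaban3D.Proofs.LogZLocalized
open Summit.QuantumFields.Balaban3D.Proofs.Inputs
open Summit.QuantumFields.Balaban3D.Proofs.TowerAC
open Summit.QuantumFields.Balaban3D.Proofs.SeriesAC
open Summit.QuantumFields.Balaban3D.Proofs.StandardAC
open Summit.QuantumFields.Balaban3D.Proofs.InputsAC
open Summit.QuantumFields.Balaban3D.Proofs.Bound55AC
open Summit.QuantumFields.Balaban3D.Proofs.LeavesReprAC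
open Summit.QuantumFields.Balaban3D.Proofs.LeavesCumAC

variable {L : ℕ} (𝔎 : LaneConsts L) {S : Scales L} {G : Type} [GaugeGroup G] [MeasurableSpace G] [HaarData G]
  {V : Type} [NormedAddCommGroup V] [NormedSpace ℂ V]
  (X : ExternalInputsAC S G) (𝔖 : ∀ k, StepSeries S G V (nblkOf S 𝔎.carrier k) k) (k : ℕ)

/-- **Row C5 AT THE LANE'S PIECES** — (33) p. 264 / (60) p. 271 for `Inputs.pieces 𝔎 X 𝔖 k` with the record's `C₂`, from p6's
`repr33_60_std`: (α) inputs G3D-01 `chart`, (28) `bound28`/`small28`, (26)+detecting `inv26`/`hdet` (⇒ (32)), G3D-06 `far_le`, the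
identification `hPY`; constants `hC₂`, `κ ≥ κ₀(32,6)`, `0 ≤ C25`, `C25·K₀ ≤ CM`, `κ₀ < ½`; the slots `k ≤ K`, `0 < p₀`, `0 ≤ b₀`,
`Nblk³ ≤ |T₁^{(k)}|` DISCHARGED. [cite: Balaban1985UV3, (33) p.264 + (60) p.271] -/
theorem repr33_60_piecesAC [FiniteDimensional ℂ V] (hk : k + 1 ≤ S.K) (κc : ChartConsts) {κ C25 : ℝ}
    (hκ : kappa₀ (4 * 2 ^ 3) (2 * 3) ≤ κ) (hC25 : 0 ≤ C25) (hCM : C25 * K₀ (4 * 2 ^ 3) (2 * 3) ≤ κc.CM)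
    (hκ₀ : 𝔎.F.κ₀ < 1 / 2) (hC₂ : 𝔎.sc.C₂ = rawConst7 κc.Craw 𝔎.F.b₀ κc.r₀ 𝔎.F.p₀ 1 𝔎.F.κ₀)
    (chart : ∀ Y, ChartAnalyticityAsCited ((𝔖 k).Ψ Y) κc.ρ
      (C25 * S.gk k * Real.exp (-(κ * (tsys 3 (nblkOf S 𝔎.carrier k)).dj Y))))
    (bound28 : ∀ Y h U, ‖(𝔖 k).Bcfg Y h U‖ ≤ κc.cB * (rFun κc.r₀ (S.gk k) * S.gk k * pFun 𝔎.F.b₀ 𝔎.F.p₀ (S.gk k)))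
    (small28 : κc.cB * (rFun κc.r₀ (S.gk k) * S.gk k * pFun 𝔎.F.b₀ 𝔎.F.p₀ (S.gk k)) ≤ κc.ρ / 4)
    {Γ : Type*} (π : Γ → (𝔖 k).E →L[ℂ] (𝔖 k).E)
    (inv26 : ∀ Y u, ∀ b ∈ ball (0 : (𝔖 k).E) κc.ρ, π u b ∈ ball (0 : (𝔖 k).E) κc.ρ → (𝔖 k).Ψ Y (π u b) = (𝔖 k).Ψ Y b)
    (hdet : ∀ ψ : (𝔖 k).E →L[ℂ] ℂ, (∀ u, ψ.comp (π u) = ψ) → ψ = 0)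
    (far_le : FarTermsDecayAsCited (𝔖 k).far (fun Y => C25 * S.gk k * Real.exp (-(κ * (tsys 3 (nblkOf S 𝔎.carrier k)).dj Y)))
      κc.Cfar (S.gk k ^ 7 * (rFun κc.r₀ (S.gk k) * pFun 𝔎.F.b₀ 𝔎.F.p₀ (S.gk k)) ^ 7))
    (hPY : ∀ h U, (𝔖 k).PY h U
      = ∑ Y ∈ (𝔖 k).loc (ΩblkOf 𝔎.carrier.M₁ (rcolOf S 𝔎.carrier) (nblkOf S 𝔎.carrier k)) (rretOf S 𝔎.carrier k) h,
          ((jet26 ((𝔖 k).Ψ Y) ((𝔖 k).Bcfg Y h U)).re - (𝔖 k).far Y h U)) :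
    Repr33_60 (piecesAC 𝔎 X 𝔖 k) 𝔎.sc.C₂ := by
  rw [hC₂]
  exact repr33_60_seriesAC (X.toTowerBase 𝔎.carrier) 𝔖 (piecesParamsOf S 𝔎.carrier) k (by omega) κc hκ hC25 hCM hκ₀ 𝔎.F.p₀_pos
    𝔎.F.b₀_nonneg (nblk_cube_le_sites 𝔎 k (by omega)) (Run3RepresentationStd.rem_std 𝔎.carrier k) chart bound28 small28 π inv26 hdet
    far_le hPY

/-! ## C6 — `vacuumWhole` -/

/-- **Row C6 AT THE LANE'S PIECES** — the whole-lattice vacuum sum (p. 265 L2–4 / p. 270 L30–33) for `Inputs.pieces 𝔎 X 𝔖 k` with the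
record's `Cv`, `C₃`, from p6's `vacuumWhole_std`: (α) input G3D-01 `chart`; constants `hCv`, `hC₃`, `κ ≥ κ₀(32,6)+1`, `0 ≤ C25`; the slots
`k ≤ K`, `0 < κ₀`, `r₀ ≥ 1`, `R₁ ≥ 6 + 2κ₀`, `Nblk³ ≤ |T₁^{(k)}|`, the retained radius (`rfl`) and the block count (p1's theorem) DISCHARGED.
[cite: Balaban1985UV3, p.265 + p.270 + (25) p.262] -/
theorem vacuumWhole_piecesAC (hk : k + 1 ≤ S.K) {ρ κ C25 : ℝ} (hκ : kappa₀ (4 * 2 ^ 3) (2 * 3) + 1 ≤ κ) (hC25 : 0 ≤ C25)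
    (hr₀ : 1 ≤ 𝔎.F.r₀) (hR₁ : 6 + 2 * 𝔎.F.κ₀ ≤ 𝔎.F.R₁)
    (hCv : 𝔎.sc.Cv = C25 * K₀ (4 * 2 ^ 3) (2 * 3))
    (hC₃ : 𝔎.sc.C₃ = rawConstR (C25 * K₀ (4 * 2 ^ 3) (2 * 3)) 𝔎.F.R₁ 1 𝔎.F.κ₀)
    (chart : ∀ Y, ChartAnalyticityAsCited ((𝔖 k).Ψ Y) ρ
      (C25 * S.gk k * Real.exp (-(κ * (tsys 3 (nblkOf S 𝔎.carrier k)).dj Y)))) :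
    VacuumWhole (piecesAC 𝔎 X 𝔖 k) 𝔎.sc.Cv 𝔎.sc.C₃ := by
  rw [hCv, hC₃]
  exact vacuumWhole_seriesAC (X.toTowerBase 𝔎.carrier) 𝔖 (piecesParamsOf S 𝔎.carrier) k (by omega) hκ hC25 𝔎.F.κ₀_pos hr₀ hR₁
    (nblk_cube_le_sites 𝔎 k (by omega)) (Run3RepresentationStd.rem_std 𝔎.carrier k) rfl chart

/-! ## C7 — `decomp35_61` from the TREE binder G3D-07 -/

/-- **Row C7 AT THE LANE'S PIECES** — (35)/(61) pp. 265/271 for `Inputs.pieces 𝔎 X 𝔖 k` with the record's `C₄`, from p6's `decomp35_61_std`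
with «(63) as cited» = the lane's GAP binder G3D-07 `Binders.LogZLocalizedAsCited` for the DEFINED `logZU`/`logZ1` of the pieces, the
domains inside `Ω_{k+1}(h)`, the chart configurations `Bcfg` and a linear action `π` (p6 `LogZLocalization.ofCited` + the detecting
property `hdet`): further (α) inputs (28) `bound28`/`small28`, the identification `hPYZ` with the binder's pieces; constants `hC₄`,
`κ ≥ κ₀(32,6)+1`, `0 ≤ C63`, `C63·K₀ ≤ CM`, `κc.r₀ = r₀`, `κ₀ < ½`; the slots `k ≤ K`, `r₀ ≥ 1`, `0 < κ₀`, `R₁ ≥ 6 + 2κ₀`, `0 < p₀`,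
`0 ≤ b₀`, `Nblk³ ≤ |T₁^{(k)}|` DISCHARGED. [cite: Balaban1985UV3, (61) p.271 + (63) p.272 + (35) p.265] -/
theorem decomp35_61_piecesAC [FiniteDimensional ℂ V] (hk : k + 1 ≤ S.K) (κc : ChartConsts) (hr : κc.r₀ = 𝔎.F.r₀) {κ C63 : ℝ}
    (hκ : kappa₀ (4 * 2 ^ 3) (2 * 3) + 1 ≤ κ) (hC63 : 0 ≤ C63) (hCM : C63 * K₀ (4 * 2 ^ 3) (2 * 3) ≤ κc.CM)
    (hr₀ : 1 ≤ 𝔎.F.r₀) (hκ₀ : 𝔎.F.κ₀ < 1 / 2) (hR₁ : 6 + 2 * 𝔎.F.κ₀ ≤ 𝔎.F.R₁)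
    (hC₄ : 𝔎.sc.C₄ = rawConst7 κc.Craw 𝔎.F.b₀ 𝔎.F.r₀ 𝔎.F.p₀ 1 𝔎.F.κ₀
      + rawConstR (2 * C63 * K₀ (4 * 2 ^ 3) (2 * 3)) 𝔎.F.R₁ 1 𝔎.F.κ₀)
    (bound28 : ∀ Y h U, ‖(𝔖 k).Bcfg Y h U‖ ≤ κc.cB * (rFun κc.r₀ (S.gk k) * S.gk k * pFun 𝔎.F.b₀ 𝔎.F.p₀ (S.gk k)))
    (small28 : κc.cB * (rFun κc.r₀ (S.gk k) * S.gk k * pFun 𝔎.F.b₀ 𝔎.F.p₀ (S.gk k)) ≤ κc.ρ / 4)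
    {Γ : Type} (π : Γ → (𝔖 k).E →L[ℂ] (𝔖 k).E)
    (hdet : ∀ ψ : (𝔖 k).E →L[ℂ] ℂ, (∀ u, ψ.comp (π u) = ψ) → ψ = 0)
    (Λc : LogZLocalizedAsCited (towerOfAC 𝔎 X 𝔖) k (𝔖 k).E π κc.ρ κc.r₀ κc.Cfar C63 κ (piecesAC 𝔎 X 𝔖 k).logZU
      (piecesAC 𝔎 X 𝔖 k).logZ1 (𝔖 k).Bcfg
      (fun h => Finset.univ.filter fun Y : (tsys 3 (nblkOf S 𝔎.carrier k)).Dom =>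
        Y.1 ⊆ ΩblkOf 𝔎.carrier.M₁ (rcolOf S 𝔎.carrier) (nblkOf S 𝔎.carrier k) h))
    (hPYZ : ∀ h U, (𝔖 k).PYZ h U
      = ∑ Y ∈ (𝔖 k).loc (ΩblkOf 𝔎.carrier.M₁ (rcolOf S 𝔎.carrier) (nblkOf S 𝔎.carrier k)) (rretOf S 𝔎.carrier k) h,
          ((jet26 (Λc.Ψ Y) ((𝔖 k).Bcfg Y h U)).re - Λc.far Y h U)) :
    Decomp35_61 (piecesAC 𝔎 X 𝔖 k) 𝔎.sc.C₄ := by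
  rw [hC₄]
  have h := decomp35_61_seriesAC (X.toTowerBase 𝔎.carrier) 𝔖 (piecesParamsOf S 𝔎.carrier) k (by omega) κc hκ hC63 hCM (hr ▸ hr₀)
    𝔎.F.κ₀_pos hκ₀ hR₁ 𝔎.F.p₀_pos 𝔎.F.b₀_nonneg (nblk_cube_le_sites 𝔎 k (by omega)) (Run3RepresentationStd.rem_std 𝔎.carrier k)
    (by rw [hr]; rfl) bound28 small28 (LogZLocalization.ofCited Λc hdet) hPYZ
  rw [hr] at h
  exact h

/-! ## C8 — `norm35`, B20 — `logZT_le`: the GAP binders G3D-04 / G3D-05 BY NAME -/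

/-- **Row C8 AT THE LANE'S PIECES** — (35) p. 265 (and its unprinted k ≥ 1 analogue) for `Inputs.pieces 𝔎 X 𝔖 k` with the record's
`C₅`: the GAP binder G3D-04 `Binders.Norm35StepAsCited` at the pieces, `0 < c`, and `hC₅ : C₅ = cv·(log 2π + max(|log c|,|log a|))/2
+ cJ` (p6 `norm35_series`). [cite: Balaban1985UV3, (35) p.265] -/
theorem norm35_piecesAC {c a cv cJ : ℝ} (hc : 0 < c)
    (hC₅ : 𝔎.sc.C₅ = cv * ((Real.log (2 * Real.pi) + max |Real.log c| |Real.log a|) / 2) + cJ)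
    (h35 : Norm35StepAsCited (piecesAC 𝔎 X 𝔖 k) c a cv cJ) : Norm35 (piecesAC 𝔎 X 𝔖 k) 𝔎.sc.C₅ := by
  rw [hC₅]
  exact norm35_seriesAC (X.toTowerBase 𝔎.carrier) 𝔖 (piecesParamsOf S 𝔎.carrier) k hc h35

/-- **Row B20 AT THE LANE'S PIECES** — `|log Z^{(k)}(T₁^{(k)}, 1)| ≤ z|T₁^{(k)}|` (p. 273, (65) input) for `Inputs.pieces 𝔎 X 𝔖 k` with
the record's `z`: the GAP binder G3D-05 `Binders.LogZTExtensiveAsCited` at the pieces, `0 < c`, and `hz : z = cn·(log 2π +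
max(|log c|,|log a|))/2 + cJ` (p6 `logZT_le_series`) — literally the `RunResiduals.logZT_le` field at step `k`. [cite: Balaban1985UV3, (65) p.273] -/
theorem logZT_le_piecesAC {c a cn cJ : ℝ} (hc : 0 < c)
    (hz : 𝔎.F.z = cn * ((Real.log (2 * Real.pi) + max |Real.log c| |Real.log a|) / 2) + cJ)
    (hZT : LogZTExtensiveAsCited (piecesAC 𝔎 X 𝔖 k) c a cn cJ) :
    |(piecesAC 𝔎 X 𝔖 k).logZT| ≤ 𝔎.F.z * S.sites k := by
  rw [hz]
  exact logZT_le_seriesAC (X.toTowerBase 𝔎.carrier) 𝔖 (piecesParamsOf S 𝔎.carrier) k hc hZT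


open Classical in
/-- **Row C3 AT THE LANE'S PIECES** — (24) p. 262 / (58)–(59) p. 270 for `Inputs.pieces 𝔎 X 𝔖 k` with the record's `Cz`, `C₁`, from
p5's `cumulant58_series_std` (the printed cumulants are the DEFINED `(𝔖 k).cum`, R-324; the (3.24) re-expansion input (b) vanishes):
(α) inputs (3.24)(a) `h324a`, (c) `h324c` (unit `(L^kg₀²)^{3+κ₀}|T₁^{(k)}|`), G3D-02 `hG` + R-ACT `hact`, (25) `h25`; regularity `hμ`,
`hboxm`, `hbox`, `hVm`, `hVB`; constants `hCz`, `hC₁`, `κ ≥ κ₀(32,6)+1`, `0 ≤ C25`, `0 ≤ Ca + Cc`; the slots `k ≤ K`, `0 < κ₀`, `r₀ ≥ 1`,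
`R₁ ≥ 6 + 2κ₀` (record), `rem`/`Rret` (`rfl`), `Nblk³ ≤ |T₁^{(k)}|` (`Inputs.nblk_cube_le_sites`) DISCHARGED. [cite: Balaban1985UV3, (24) p.262 + (58)–(59) p.270] -/
theorem cumulant58_piecesAC (hk : k + 1 ≤ S.K) (hμ : IsProbabilityMeasure (𝔖 k).μ) {κ C25 : ℝ}
    (hκ : kappa₀ (4 * 2 ^ 3) (2 * 3) + 1 ≤ κ) (hC25 : 0 ≤ C25) (hr₀ : 1 ≤ 𝔎.F.r₀) (hR₁ : 6 + 2 * 𝔎.F.κ₀ ≤ 𝔎.F.R₁)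
    {C₂₃ c M₁ δ₀ : ℝ} {nbar : ℕ} {Ca Cc Bv : ℝ} (hCac : 0 ≤ Ca + Cc)
    (hCz : 𝔎.sc.Cz = C25 * K₀ (4 * 2 ^ 3) (2 * 3))
    (hC₁ : 𝔎.sc.C₁ = 0 + C25 * K₀ (4 * 2 ^ 3) (2 * 3) * Real.exp (-𝔎.F.R₁) + (Ca + 0 + Cc))
    (hact : ∀ h Y U, ((𝔖 k).Gt h).activities.act Y U = (𝔖 k).act h Y U)
    (hboxm : ∀ h, MeasurableSet ((𝔖 k).box h)) (hbox : ∀ h, (𝔖 k).μ ((𝔖 k).box h) ≠ 0)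
    (hVm : ∀ h U, AEMeasurable ((𝔖 k).𝒱 h U) (𝔖 k).μ) (hVB : ∀ h U, ∀ ω ∈ (𝔖 k).box h, |(𝔖 k).𝒱 h U ω| ≤ Bv)
    (h324a : ∀ h (U : GaugeField S.P (k + 1) G), |Real.log ((𝔖 k).μ.real ((𝔖 k).box h))| ≤
      Ca * ((L : ℝ) ^ k * S.g0sq) ^ (3 + 𝔎.F.κ₀) * S.sites k)
    (h324c : ∀ h U, ∀ t ∈ Set.Icc (0 : ℝ) 1, |iteratedDeriv (nbar + 1) (ProbabilityTheory.cgf ((𝔖 k).𝒱 h U)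
        (chiMeasure (𝔖 k).μ (((𝔖 k).box h).indicator fun _ => (1 : ℝ)))) t| ≤
          Cc * ((nbar + 1)! : ℝ) * ((L : ℝ) ^ k * S.g0sq) ^ (3 + 𝔎.F.κ₀) * S.sites k)
    (hG : ∀ h, GraphRep23AsCited ((𝔖 k).Gt h) (fun U => ∑ n ∈ Finset.Icc 1 nbar, (𝔖 k).cum h U n / (n ! : ℝ)) C₂₃ c M₁ δ₀)
    (h25 : ∀ h, Bound25Printed ⟨(tsys 3 (𝔖 k).Nblk).Dom, GaugeField S.P (k + 1) G, (tsys 3 (𝔖 k).Nblk).dj, (𝔖 k).act h⟩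
      (S.gk k) κ C25) :
    Cumulant58 (piecesAC 𝔎 X 𝔖 k) 𝔎.sc.Cz 𝔎.sc.C₁ := by
  haveI := hμ
  rw [hCz, hC₁]
  exact cumulant58_series_stdAC (X.toTowerBase 𝔎.carrier) 𝔖 (piecesParamsOf S 𝔎.carrier) k hκ hC25 hact hboxm hbox hVm hVB h324a
    h324c hCac (by omega) 𝔎.F.κ₀_pos hr₀ hR₁ (norm_rem_eq S 𝔎.F.κ₀ k).symm rfl (nblk_cube_le_sites 𝔎 k (by omega)) hG h25

open Classical in
open Classical in
/-- **Row C4 AT THE LANE'S PIECES** — the lower cumulant direction at the trivial history ((37) p. 265 / p. 272 / (59) p. 270) with the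
record's `C₁'`, from p5's `cumulantLower_series_std`; same inputs as `cumulant58_pieces` with `hC₁'` in place of `hCz`/`hC₁`.
[cite: Balaban1985UV3, (37) p.265 + p.272 + (59) p.270] -/
theorem cumulantLower_piecesAC (hk : k + 1 ≤ S.K) (hμ : IsProbabilityMeasure (𝔖 k).μ) {κ C25 : ℝ}
    (hκ : kappa₀ (4 * 2 ^ 3) (2 * 3) + 1 ≤ κ) (hC25 : 0 ≤ C25) (hr₀ : 1 ≤ 𝔎.F.r₀) (hR₁ : 6 + 2 * 𝔎.F.κ₀ ≤ 𝔎.F.R₁)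
    {C₂₃ c M₁ δ₀ : ℝ} {nbar : ℕ} {Ca Cc Bv : ℝ} (hCac : 0 ≤ Ca + Cc)
    (hC₁' : 𝔎.sc.C₁' = 0 + C25 * K₀ (4 * 2 ^ 3) (2 * 3) * Real.exp (-𝔎.F.R₁) + (Ca + 0 + Cc))
    (hact : ∀ h Y U, ((𝔖 k).Gt h).activities.act Y U = (𝔖 k).act h Y U)
    (hboxm : ∀ h, MeasurableSet ((𝔖 k).box h)) (hbox : ∀ h, (𝔖 k).μ ((𝔖 k).box h) ≠ 0)
    (hVm : ∀ h U, AEMeasurable ((𝔖 k).𝒱 h U) (𝔖 k).μ) (hVB : ∀ h U, ∀ ω ∈ (𝔖 k).box h, |(𝔖 k).𝒱 h U ω| ≤ Bv)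
    (h324a : ∀ h (U : GaugeField S.P (k + 1) G), |Real.log ((𝔖 k).μ.real ((𝔖 k).box h))| ≤
      Ca * ((L : ℝ) ^ k * S.g0sq) ^ (3 + 𝔎.F.κ₀) * S.sites k)
    (h324c : ∀ h U, ∀ t ∈ Set.Icc (0 : ℝ) 1, |iteratedDeriv (nbar + 1) (ProbabilityTheory.cgf ((𝔖 k).𝒱 h U)
        (chiMeasure (𝔖 k).μ (((𝔖 k).box h).indicator fun _ => (1 : ℝ)))) t| ≤
          Cc * ((nbar + 1)! : ℝ) * ((L : ℝ) ^ k * S.g0sq) ^ (3 + 𝔎.F.κ₀) * S.sites k)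
    (hG : ∀ h, GraphRep23AsCited ((𝔖 k).Gt h) (fun U => ∑ n ∈ Finset.Icc 1 nbar, (𝔖 k).cum h U n / (n ! : ℝ)) C₂₃ c M₁ δ₀)
    (h25 : ∀ h, Bound25Printed ⟨(tsys 3 (𝔖 k).Nblk).Dom, GaugeField S.P (k + 1) G, (tsys 3 (𝔖 k).Nblk).dj, (𝔖 k).act h⟩
      (S.gk k) κ C25) :
    CumulantLower (piecesAC 𝔎 X 𝔖 k) 𝔎.sc.C₁' := by
  haveI := hμ
  rw [hC₁']
  exact cumulantLower_series_stdAC (X.toTowerBase 𝔎.carrier) 𝔖 (piecesParamsOf S 𝔎.carrier) k hκ hC25 hact hboxm hbox hVm hVB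
    h324a h324c hCac (by omega) 𝔎.F.κ₀_pos hr₀ hR₁ (norm_rem_eq S 𝔎.F.κ₀ k).symm rfl (nblk_cube_le_sites 𝔎 k (by omega)) hG h25

/-! ## B21 — `PprT_le` -/

open Classical in
open Classical in
/-- **Row B21 AT THE LANE'S PIECES** — `|Σ_X 𝒫′_{k+1}(g_k, X, 1)| ≤ aP|T₁^{(k)}|` (p. 273, from (25)) for `Inputs.pieces 𝔎 X 𝔖 k` with the
record's `aP`, from p5's `pprT_le_series_std`: (α) input (25) for the vacuum activities `Re Ψ_X(0)` (`h25vac`; = G3D-01 at the chart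
centre); constants `haP : aP = C25·K₀(32,6)`, `κ ≥ κ₀(32,6)`, `0 ≤ C25`; the slots `k ≤ K`, `Nblk³ ≤ |T₁^{(k)}|` DISCHARGED —
literally the `RunResiduals.PprT_le` field at step `k`. [cite: Balaban1985UV3, (62) p.271 + p.273] -/
theorem pprT_le_piecesAC (hk : k + 1 ≤ S.K) {κ C25 : ℝ} (hκ : kappa₀ (4 * 2 ^ 3) (2 * 3) ≤ κ) (hC25 : 0 ≤ C25)
    (haP : 𝔎.F.aP = C25 * K₀ (4 * 2 ^ 3) (2 * 3))
    (h25vac : Bound25Printed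
      ⟨(tsys 3 (𝔖 k).Nblk).Dom, GaugeField S.P (k + 1) G, (tsys 3 (𝔖 k).Nblk).dj, fun Y _ => ((𝔖 k).Ψ Y 0).re⟩
        (S.gk k) κ C25) :
    |(piecesAC 𝔎 X 𝔖 k).PprT| ≤ 𝔎.F.aP * S.sites k := by
  rw [haP]
  exact pprT_le_series_stdAC (X.toTowerBase 𝔎.carrier) 𝔖 (piecesParamsOf S 𝔎.carrier) k hκ hC25 (by omega) (fun _ => 1) h25vac
    (nblk_cube_le_sites 𝔎 k (by omega))


/-- **`Rm_k ≥ 0` for the lane's tower**: the booked remainder `Σ_{j<k} rcoef j·(L^jε)^{3+κ₀}|T₁^{(j)}|` has `rcoef j = rstar·g^{6+2κ₀} ≥ 0`.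
[cite: Balaban1985UV3, (41) p.266] -/
theorem rm_nonnegAC : 0 ≤ (towerWAC 𝔎 X 𝔖).Rm k := by
  show 0 ≤ ∑ j ∈ Finset.range k, (inputOfAC 𝔎 X 𝔖).rcoef j * ((L : ℝ) ^ j * S.ε) ^ (3 + (inputOfAC 𝔎 X 𝔖).κ₀) * S.sites j
  refine Finset.sum_nonneg fun j _ => ?_
  have hr : 0 ≤ (inputOfAC 𝔎 X 𝔖).rcoef j := by
    show 0 ≤ 𝔎.sc.rstar * S.g ^ ((6 : ℝ) + 2 * 𝔎.F.κ₀)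
    exact mul_nonneg 𝔎.sc.rstar_nonneg (Real.rpow_nonneg S.g_pos.le _)
  exact mul_nonneg (mul_nonneg hr (Real.rpow_nonneg (pow_mul_eps_pos S j).le _)) (sites_nonneg S j)

/-! ## C1 / C2 at the lane's pieces -/

/-- **Row C1 AT THE LANE'S PIECES** — (22) p. 261 / (55)·(58) pp. 269–270 (`Bound55 (piecesAC 𝔎 X 𝔖 k)`) from seat p4's `bound55_std` at the
unpinned pieces `piecesW` and the transport `bound55_pieces_of_unpinned`: hypotheses = the RESIDUAL R3D-01 `Fibre49` for every new history
and the integrability `hint` of the (41)_k summands; DISCHARGED: the step's threshold ordering `ε_L(k) ≤ ε_S(k)` (`eps1Of_le_epsSOf`, `k ≤ K`;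
p4's `hLS` is per step since Bound55Std v2), the barrier pinnings (`rfl`: p1 `stdTowerInput_upper`/`_lower` — the pieces ARE p1's
`seriesPieces` at `piecesParamsOf`), `Rm_k ≥ 0` (`rm_nonneg`).
[cite: Balaban1985UV3, (22) p.261 + (55) p.269 + (58) p.270] -/
theorem bound55_piecesAC [RegularGaugeGroup G] (hk : k + 1 ≤ S.K)
    (hint : ∀ h : Hist S.P k, Integrable (fun U => (inputOfAC 𝔎 X 𝔖).W.mass k h U *
      Real.exp (-((towerWAC 𝔎 X 𝔖).mainT k h U) + (inputOfAC 𝔎 X 𝔖).Pint k h U - (towerWAC 𝔎 X 𝔖).Ecst k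
        + (towerWAC 𝔎 X 𝔖).Zterm k h + (towerWAC 𝔎 X 𝔖).Rm k)) (fieldMeasure S.P k G))
    (hfibre : ∀ h' : Hist S.P (k + 1), Fibre49AC X 𝔎.carrier 𝔖 (fun _ => True) k (piecesWAC 𝔎 X 𝔖 k) h') :
    Bound55 (piecesAC 𝔎 X 𝔖 k) :=
  bound55_piecesAC_of_unpinned 𝔎 X 𝔖 k
    (bound55_stdAC X 𝔎.carrier 𝔖 (fun _ => True) k (piecesWAC 𝔎 X 𝔖 k)
      (AlphaBound55.eps1Of_le_epsSOf k 𝔎.carrier 𝔎.F.b₀_nonneg 𝔎.F.p₀_pos.le (by omega)) hint hfibre (fun _ => rfl) (fun _ => rfl)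
      (rm_nonnegAC 𝔎 X 𝔖 k))

/-- **Row C2 AT THE LANE'S PIECES** — the lower twin (`Bound55Lower (piecesAC 𝔎 X 𝔖 k)`; p. 265 L21–28 / p. 272 L32–33) from seat p4's
`bound55Lower_std` at `piecesW` and `bound55Lower_pieces_of_unpinned`: hypotheses = the RESIDUAL R3D-02 `Fibre57Low` and the integrability
`hint47` of the (47)_k left-hand side; the lower-barrier pinning is `rfl`. [cite: Balaban1985UV3, p.265 L21–28 + (47) p.267 + p.272 L32–33] -/
theorem bound55Lower_piecesAC [RegularGaugeGroup G]
    (hint47 : Integrable (fun U => (towerWAC 𝔎 X 𝔖).chi k U *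
      Real.exp (-((towerWAC 𝔎 X 𝔖).mainT k (Hist.triv S.P k) U) + (inputOfAC 𝔎 X 𝔖).Pint k (Hist.triv S.P k) U
        - (towerWAC 𝔎 X 𝔖).Ecst k - (towerWAC 𝔎 X 𝔖).Rm k)) (fieldMeasure S.P k G))
    (hfibreLow : Fibre57LowAC X 𝔎.carrier 𝔖 (fun _ => True) k (piecesWAC 𝔎 X 𝔖 k)) :
    Bound55Lower (piecesAC 𝔎 X 𝔖 k) :=
  bound55Lower_piecesAC_of_unpinned 𝔎 X 𝔖 k
    (bound55Lower_stdAC X 𝔎.carrier 𝔖 (fun _ => True) k (piecesWAC 𝔎 X 𝔖 k) hint47 hfibreLow (fun _ => rfl))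


end Summit.QuantumFields.Balaban3D.Proofs.AlphaAdaptersAC

end
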